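import Literature.AlgebraicGeometry.Limits.LocalizationIsoSpreadCompat
import Literature.AlgebraicGeometry.Limits.PushoutOpenImmersion
import HarnessLib

/-!
# Limits of schemes: descending the overlap of two descended charts

Topic: `Literature/AlgebraicGeometry/Limits`; part of the proof of Stacks 01ZM / EGA IV₃ 8.8.2 (ii)
for the localization diagram `Spec A_S = lim_s Spec A[1/s]` (`Limits/LocalizationTwoOpensDescent`,
`Limits/LocalizationSchemeDescent`). Setting: `B = A_S`, an `A`-scheme `P` (quasi-compact,
quasi-separated, locally of finite presentation) and a quasi-compact open subset `O'` of a stage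
`P ⊗ Spec A[1/s]`. We record the **chart** `chart P s O'` — the open subscheme `O'` regarded as an
`A`-scheme — with its open immersion `chartι : chart P s O' → P`, its finiteness properties, and
the computation of the range of `chartι ⊗ Spec B` as the preimage of `O'` in `P ⊗ Spec B`
(`range_chartι_whiskerRight_left`). In the two-opens descent, `O'` descends the overlap
`U ∩ V ⊆ U = P ⊗ Spec B` of two descended charts, and `chart` is the `A`-scheme of finite
presentation along which the two charts are glued at a finite stage.

## References

* The Stacks project, Tags 01Z4, 01ZM. [StacksProject]
* A. Grothendieck, EGA IV₃, Thm. 8.8.2 (ii) (Publ. Math. IHÉS 28, 1966). [EGAIV3]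
-/

noncomputable section

universe u

open CategoryTheory CategoryTheory.Limits AlgebraicGeometry TopologicalSpace MonoidalCategory
  CartesianMonoidalCategory
open Opposite

namespace Literature.AlgebraicGeometry.Limits

namespace LocApprox

open Literature.AlgebraicGeometry.Motives (SchemeOver specOver)

set_option backward.isDefEq.respectTransparency false

variable {A : Type u} [CommRing A] (S : Submonoid A) (B : Type u) [CommRing B] [Algebra A B]
  [IsLocalization S B]

section Chart

variable {S}
variable (P : SchemeOver A) (s : Idx S) (O' : ((P ⊗ (baseDiagram S).obj s).left).Opens)

/-- The open subscheme `O'` of the stage `P ⊗ Spec A[1/s]`, as an `A`-scheme (structure map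
through `P ⊗ Spec A[1/s] → P → Spec A`). [folklore] -/
def chart : SchemeOver A :=
  Over.mk (O'.ι ≫ pullback.fst P.hom ((baseDiagram S).obj s).hom ≫ P.hom)

/-- The structure map of `chart P s O'` (by `rfl`). [folklore] -/
theorem chart_hom :
    (chart P s O').hom = O'.ι ≫ pullback.fst P.hom ((baseDiagram S).obj s).hom ≫ P.hom := rfl

/-- The open immersion `chart P s O' → P` over `Spec A` (`O' ⊆ P ⊗ Spec A[1/s] → P`). [folklore] -/
def chartι : chart P s O' ⟶ P :=
  Over.homMk (O'.ι ≫ pullback.fst P.hom ((baseDiagram S).obj s).hom) rfl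

/-- The total-space component of `chartι` (by `rfl`). [folklore] -/
theorem chartι_left : (chartι P s O').left = O'.ι ≫ pullback.fst P.hom ((baseDiagram S).obj s).hom :=
  rfl

/-- `chartι` is an open immersion on total spaces. [folklore] -/
instance isOpenImmersion_chartι_left : IsOpenImmersion (chartι P s O').left := by
  rw [chartι_left]
  infer_instance

/-- `chart P s O' → Spec A` is locally of finite presentation if `P → Spec A` is. [folklore] -/
instance locallyOfFinitePresentation_chart_hom [LocallyOfFinitePresentation P.hom] :
    LocallyOfFinitePresentation (chart P s O').hom := by
  rw [chart_hom]
  infer_instance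

/-- `chart P s O' → Spec A` is quasi-separated if `P → Spec A` is. [folklore] -/
instance quasiSeparated_chart_hom [QuasiSeparated P.hom] : QuasiSeparated (chart P s O').hom := by
  rw [chart_hom]
  infer_instance

variable {P s O'} in
/-- `chart P s O' → Spec A` is quasi-compact if `P → Spec A` is quasi-compact and quasi-separated
and `O'` is quasi-compact. [folklore] -/
theorem quasiCompact_chart_hom [QuasiCompact P.hom] [QuasiSeparated P.hom]
    (hO' : IsCompact (O' : Set (P ⊗ (baseDiagram S).obj s).left)) :
    QuasiCompact (chart P s O').hom := by
  haveI : CompactSpace O' := isCompact_iff_compactSpace.mp hO'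
  haveI : QuasiCompact O'.ι := (quasiCompact_iff_compactSpace O'.ι).mpr inferInstance
  rw [chart_hom]
  infer_instance

/-- Membership in the range of `chartι : chart → P` on total spaces: the points `fstₛ o`,
`o ∈ O'` (`fstₛ : P ⊗ Spec A[1/s] → P`). [folklore] -/
theorem mem_range_chartι_left_iff (y : P.left) :
    y ∈ Set.range (chartι P s O').left ↔
      ∃ o : (P ⊗ (baseDiagram S).obj s).left, o ∈ O' ∧
        pullback.fst P.hom ((baseDiagram S).obj s).hom o = y := by
  constructor
  · rintro ⟨x, rfl⟩
    exact ⟨O'.ι x, by simp, rfl⟩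
  · rintro ⟨o, ho, rfl⟩
    exact ⟨⟨o, ho⟩, rfl⟩

/-- **The range of `chartι ⊗ Spec B : chart ⊗ Spec B → P ⊗ Spec B` is the preimage of `O'` under
`P ⊗ Spec B → P ⊗ Spec A[1/s]`.** [folklore] -/
theorem range_chartι_whiskerRight_left :
    Set.range (chartι P s O' ▷ specOver A B).left =
      (P ◁ leg S B s).left ⁻¹' (O' : Set (P ⊗ (baseDiagram S).obj s).left) := by
  rw [range_whiskerRight_left]
  ext x
  rw [Set.mem_preimage, mem_range_chartι_left_iff, Set.mem_preimage]
  have hx : pullback.fst P.hom (specOver A B).hom x =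
      pullback.fst P.hom ((baseDiagram S).obj s).hom ((P ◁ leg S B s).left x) :=
    (congrArg (fun k => k x) (Over.whiskerLeft_left_fst (R := P) (leg S B s))).symm
  rw [hx]
  constructor
  · rintro ⟨o, ho, he⟩
    rwa [← (pullback.fst P.hom ((baseDiagram S).obj s).hom).isOpenEmbedding.injective he]
  · intro h
    exact ⟨_, h, rfl⟩

/-- `chartι ⊗ T` is an open immersion on total spaces, for any `T`. [folklore] -/
instance isOpenImmersion_chartι_whiskerRight_left (T : SchemeOver A) :
    IsOpenImmersion (chartι P s O' ▷ T).left :=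
  MorphismProperty.of_isPullback (P := @IsOpenImmersion)
    (isPullback_whiskerRight_left (chartι P s O') T).flip inferInstance

end Chart

/-! ## The overlap of two charts -/

section Overlap

variable {S B}
variable {X : SchemeOver B} {P₁ P₂ : SchemeOver A}
  (u₁ : (Over.pullback (specOver A B).hom).obj P₁ ⟶ X)
  (u₂ : (Over.pullback (specOver A B).hom).obj P₂ ⟶ X) [IsOpenImmersion u₂.left]

omit [IsLocalization S B] in
/-- The part of the chart `P₁ ⊗ Spec B` lying over the chart `P₂ ⊗ Spec B`, as an open subset of
`(P₁ ⊗ Spec B).left`. [folklore] -/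
def overlap : ((P₁ ⊗ specOver A B).left).Opens := u₁.left ⁻¹ᵁ u₂.left.opensRange

omit [IsLocalization S B] in
/-- The underlying set of `overlap u₁ u₂`. [folklore] -/
theorem coe_overlap :
    (overlap u₁ u₂ : Set (P₁ ⊗ specOver A B).left) = u₁.left ⁻¹' Set.range u₂.left := rfl

omit [IsLocalization S B] in
/-- The image of the overlap in `X` is the intersection of the two charts. [folklore] -/
theorem image_overlap :
    u₁.left '' (overlap u₁ u₂ : Set (P₁ ⊗ specOver A B).left) =
      Set.range u₁.left ∩ Set.range u₂.left := by
  rw [coe_overlap, Set.image_preimage_eq_inter_range, Set.inter_comm]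

omit [IsLocalization S B] in
/-- If the two charts have quasi-compact intersection in `X`, the overlap is quasi-compact.
[folklore] -/
theorem isCompact_overlap [IsOpenImmersion u₁.left]
    (h : IsCompact (Set.range u₁.left ∩ Set.range u₂.left)) :
    IsCompact (overlap u₁ u₂ : Set (P₁ ⊗ specOver A B).left) := by
  have e : (overlap u₁ u₂ : Set (P₁ ⊗ specOver A B).left) =
      u₁.left ⁻¹' (Set.range u₁.left ∩ Set.range u₂.left) := by
    rw [coe_overlap, Set.preimage_inter, Set.preimage_range, Set.univ_inter]
  rw [e]
  exact (u₁.left.isOpenEmbedding.isInducing.isCompact_preimage_iff Set.inter_subset_left).mpr h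

variable {s : Idx S} (O₁' : ((P₁ ⊗ (baseDiagram S).obj s).left).Opens)
  (hO₁' : (P₁ ◁ leg S B s).left ⁻¹ᵁ O₁' = overlap u₁ u₂)

/-- The open immersion `chart ⊗ Spec B → P₁ ⊗ Spec B → X` attached to a descended overlap. [folklore] -/
def overlapι : (chart P₁ s O₁' ⊗ specOver A B).left ⟶ X.left :=
  (chartι P₁ s O₁' ▷ specOver A B).left ≫ u₁.left

/-- `overlapι` is an open immersion. [folklore] -/
instance isOpenImmersion_overlapι [IsOpenImmersion u₁.left] : IsOpenImmersion (overlapι u₁ O₁') := by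
  unfold overlapι
  infer_instance

include hO₁' in
/-- **The range of `chart ⊗ Spec B → X` is the intersection of the two charts** when `O₁'`
descends the overlap. [folklore] -/
theorem range_overlapι : Set.range (overlapι u₁ O₁') = Set.range u₁.left ∩ Set.range u₂.left := by
  rw [overlapι, Scheme.Hom.comp_base, TopCat.coe_comp, Set.range_comp, range_chartι_whiskerRight_left,
    ← image_overlap u₁ u₂, ← hO₁']
  rfl

omit [IsLocalization S B] [IsOpenImmersion u₂.left] in
/-- `overlapι` lies over `Spec B`: composed with `X → Spec B` it is the projection. [folklore] -/
theorem overlapι_comp_hom :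
    overlapι u₁ O₁' ≫ X.hom = pullback.snd (chart P₁ s O₁').hom (specOver A B).hom := by
  rw [overlapι, Category.assoc, Over.w u₁]
  exact Over.whiskerRight_left_snd _

omit [IsLocalization S B] [IsOpenImmersion u₂.left] in
/-- The structure map of `chart ⊗ Spec B` over `Spec A` factors through `overlapι` and
`X → Spec B → Spec A`. [folklore] -/
theorem tensorObj_chart_hom :
    (chart P₁ s O₁' ⊗ specOver A B).hom = overlapι u₁ O₁' ≫ X.hom ≫ (specOver A B).hom := by
  rw [Over.tensorObj_hom, pullback.condition, ← Category.assoc, overlapι_comp_hom]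

end Overlap

/-! ## The identification of the two descended overlaps -/

section Identification

variable {S B}
variable {X : SchemeOver B} {P₁ P₂ : SchemeOver A}
  (u₁ : (Over.pullback (specOver A B).hom).obj P₁ ⟶ X)
  (u₂ : (Over.pullback (specOver A B).hom).obj P₂ ⟶ X)
  [IsOpenImmersion u₁.left] [IsOpenImmersion u₂.left]
  {s : Idx S} (O₁' : ((P₁ ⊗ (baseDiagram S).obj s).left).Opens)
  (O₂' : ((P₂ ⊗ (baseDiagram S).obj s).left).Opens)
  (hO₁' : (P₁ ◁ leg S B s).left ⁻¹ᵁ O₁' = overlap u₁ u₂)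
  (hO₂' : (P₂ ◁ leg S B s).left ⁻¹ᵁ O₂' = overlap u₂ u₁)

include hO₁' hO₂' in
/-- The two open immersions `chart₁ ⊗ Spec B → X`, `chart₂ ⊗ Spec B → X` have the same range.
[folklore] -/
theorem range_overlapι_eq : Set.range (overlapι u₁ O₁') = Set.range (overlapι u₂ O₂') := by
  rw [range_overlapι u₁ u₂ O₁' hO₁', range_overlapι u₂ u₁ O₂' hO₂', Set.inter_comm]

/-- **The identification `chart₁ ⊗ Spec B ≅ chart₂ ⊗ Spec B` over `Spec A`** of the two descended
overlaps (both are the open subscheme `U ∩ V` of `X`), as an isomorphism commuting with the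
projections to `Spec B`. [folklore] -/
def overlapIso : chart P₁ s O₁' ⊗ specOver A B ≅ chart P₂ s O₂' ⊗ specOver A B :=
  Over.isoMk (IsOpenImmersion.isoOfRangeEq (overlapι u₁ O₁') (overlapι u₂ O₂')
    (range_overlapι_eq u₁ u₂ O₁' O₂' hO₁' hO₂')) (by
      rw [tensorObj_chart_hom u₁ O₁', tensorObj_chart_hom u₂ O₂',
        IsOpenImmersion.isoOfRangeEq_hom_fac_assoc])

/-- `overlapIso` composed with `chart₂ ⊗ Spec B → X` is `chart₁ ⊗ Spec B → X`. [folklore] -/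
@[reassoc]
theorem overlapIso_hom_left_overlapι :
    (overlapIso u₁ u₂ O₁' O₂' hO₁' hO₂').hom.left ≫ overlapι u₂ O₂' = overlapι u₁ O₁' :=
  IsOpenImmersion.isoOfRangeEq_hom_fac _ _ (range_overlapι_eq u₁ u₂ O₁' O₂' hO₁' hO₂')

/-- `overlapIso` commutes with the projections to `Spec B`. [folklore] -/
theorem overlapIso_hom_snd : (overlapIso u₁ u₂ O₁' O₂' hO₁' hO₂').hom ≫ snd _ _ = snd _ _ := by
  ext : 1
  change (overlapIso u₁ u₂ O₁' O₂' hO₁' hO₂').hom.left ≫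
    pullback.snd (chart P₂ s O₂').hom (specOver A B).hom =
    pullback.snd (chart P₁ s O₁').hom (specOver A B).hom
  rw [← overlapι_comp_hom u₂ O₂', ← overlapι_comp_hom u₁ O₁', overlapIso_hom_left_overlapι_assoc]

end Identification

end LocApprox

end Literature.AlgebraicGeometry.Limits

end
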